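import HarnessLib
import Summits.RiemannHypothesis.RiemannHypothesis.Theorems.WeilFormatCDataA1TabValid1
import Summits.RiemannHypothesis.RiemannHypothesis.Theorems.WeilFormatCDataA1TabValidK2
import Summits.RiemannHypothesis.RiemannHypothesis.Theorems.WeilFormatCDataA1TabValidK3
import Summits.RiemannHypothesis.RiemannHypothesis.Theorems.WeilFormatCDataA1TabValidK4
import Summits.Ventures.WeilGRH.TwistedGramCellCheckCK
import Summits.Ventures.WeilGRH.TwistedGramCellConsts
import Literature.NumberTheory.LFunctions.WeilExplicitDirichletConj
import Summits.Ventures.WeilGRH.KCellsMod9OneAData1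
import Summits.Ventures.WeilGRH.KCellsMod9OneAData2
import Summits.Ventures.WeilGRH.KCellsMod9OneAData3
import Summits.Ventures.WeilGRH.KCellsMod9OneAData4
import Summits.Ventures.WeilGRH.KCellsMod9OneAData5
import Summits.Ventures.WeilGRH.KCellsMod9OneAData6
import Summits.Ventures.WeilGRH.KCellsMod9OneAData7

/-!
SPLIT 8/8: the data and the kernel blocks of cell `c9h2` are in `KCellsMod9OneAData1`, `KCellsMod9OneAData2`, `KCellsMod9OneAData3`, `KCellsMod9OneAData4`, `KCellsMod9OneAData5`, `KCellsMod9OneAData6`, `KCellsMod9OneAData7`; this file carries the last blocks, the glue, the PSD certificate and the theorems.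
ENGINE v2 (weil-grh-2 gen15): cell checker `K` (`TwistedGramCellCheckCK`: far rows tabulated once, Schur column sums by ONE Kronecker big-integer product per pair, front door `TwistedEncl.weilPositivityOnChar_of_checkCellK`); the midpoint matrix `D` and the Cholesky factor `L` are carried PACKED (one numeral per row, 64-bit words offset `2^63`, `PsdDyadic.unpackSq` / `unpackTri`) — the statements proved are unchanged.
# χ-cells mod 9 at `t = 1` (1 even complex class + conjugates): Weil positivity for `L(s, χ)` on `[−1, 1]`

Cell `rh-explicit`, WEIL TRACK — GRH ARM (engine seat weil-grh-2 gen14).  Kernel-checked INSTANCES of the parity-0 complex data door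
`weilPositivityOnChar_of_twistedC_formatC_dataJ` (order `J = 1`) via the cell checker's front door `TwistedEncl.weilPositivityOnChar_of_checkCellC`
(`TwistedGramCellCheckC` / `…CDoor`) at the window `a = 1` of the internal `ζ` record `WeilFormatCData.A1` (prime powers `2, 3, 4, 5, 7 < e²`,
`S = 2^256`; table validity below `161` assembled inside each proof from weil-2's kernel facts `tabv26`, `tTF26`, …).
The character values are general roots of unity (orders not square-root expressible in general), so `χ(k)` enters the cell checker through
kernel-certified BOXES: `Xtabf9a[j] ∋ e(m_j/6) = exp(2πi·m_j/6)` for the exponents `m_j` of `mtabf9a` (`MC.expI` on the table's `π` box, ONE kernel check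
`tXf9a`; membership `hXf9a` by `MC.mem_expI`), and `χ(k) = χ(2)^e = exp(2πi·h·e/6)` for `k ≡ 2^e (mod 9)` from the class hypothesis `χ(2) = exp(2πi/6)^h`
(`2` generates `(ℤ/9)ˣ`, order 6; local `apply_eq` in each `hXs…`).  SHARED (tag `f9a`): `LQf9a ∋ log 9`, `CCf9a ∋ a(1+E(2a))`, `AOPf9a ∋ Σ Λ(k)/√k·2cos(π/(n_k+2))`
(floors `[2, 1, 1, 1, 1]`), the cell shape `df9a` — block `B = 30` (`59 × 59` on `|p| < 30`), Schur columns `30 ≤ |p| < 150`, far weights `wN` (units `2^-40`,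
shaved `2^16` below the kernel's `dhatCBoxA` lower bounds), crude floor `d₀` (all depend on `q` only) — and ONE sign check `tSCf9a`.
PER CELL: the five boxes `Xs…` of `χ(2), χ(3), χ(4), χ(5), χ(7)`, tail parameters `θ, η`, dyadic midpoints `D…` (units `2^-60`, radius `ρ`) and the integer
Cholesky factor `L…` of `D − δ` (kernel margin `λ` informative); all 2B−1 rows checked by ONE `checkCellCRows` kernel call (`maxRecDepth 200000`), `PsdDyadic.checkPsdMid`.
CLASSES: `χ(2) = e(2/6)` (Conrey 9.4 / conj. 9.7, order 3, λ = 0.002).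
Final theorems `weilPositivityOnChar_mod9_chi<m>_one (χ : DirichletCharacter ℂ 9) (hχ : χ (2 : ZMod 9) = exp(2πi/6) ^ h) : WeilPositivityOnChar χ 1` and
`…_conj` (the conjugate class `h ↦ 6 − h`, via `WeilPositivityOnChar χ⁻¹ a ↔ WeilPositivityOnChar χ a`).
Pure data + kernel checks + the typed door; RH/GRH-free; standard axioms.  References: H. Yoshida (1992) §§5–7 [Yoshida1992HermitianForms];
R. E. Moore (1966) Ch. 3 [Moore1966]; N. J. Higham (2002) [Higham2002ASNA].
-/

set_option linter.style.longLine false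

noncomputable section

namespace Summit.Ventures.WeilGRH.KCellsMod9OneA
open Literature.NumberTheory.LFunctions Literature.NumberTheory.LFunctions.Yoshida1992 Encl
open Literature.Analysis.ValidatedNumerics.NumericsMP Literature.Analysis.SpecialFunctions
open Summit.RiemannHypothesis.RiemannHypothesis.Theorems.WeilFormatCData.A1
open Summit.Ventures.WeilGRH.TwistedEncl
open scoped Real ComplexConjugate
set_option maxRecDepth 200000 in
/-- cell `c9h2`, rows `48…58`, columns `40…58` (checker `K`): re-computed entries within `ρ·2^-60` of the midpoints (one kernel call). [cite: Moore1966, Ch. 3 (interval arithmetic: inclusion property)] -/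
theorem tK48x40c9h2 : checkCellKBlock (2 ^ 256) C (Xsc9h2.map MC.re) (Xsc9h2.map MC.im) LQf9a tab df9a ec9h2 60 2 (PsdDyadic.unpackSq 64 59 DPc9h2) 48 11 40 19 = true := by
  set_option maxHeartbeats 0 in decide +kernel
/-- cell `c9h2`, rows `0…11`, all columns (glued). [folklore] -/
theorem tK0c9h2 : checkCellKBlock (2 ^ 256) C (Xsc9h2.map MC.re) (Xsc9h2.map MC.im) LQf9a tab df9a ec9h2 60 2 (PsdDyadic.unpackSq 64 59 DPc9h2) 0 12 0 59 = true :=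
  (checkCellKBlock_glueCols (checkCellKBlock_glueCols tK0x0c9h2 tK0x20c9h2 rfl rfl) tK0x40c9h2 rfl rfl)
/-- cell `c9h2`, rows `12…23`, all columns (glued). [folklore] -/
theorem tK12c9h2 : checkCellKBlock (2 ^ 256) C (Xsc9h2.map MC.re) (Xsc9h2.map MC.im) LQf9a tab df9a ec9h2 60 2 (PsdDyadic.unpackSq 64 59 DPc9h2) 12 12 0 59 = true :=
  (checkCellKBlock_glueCols (checkCellKBlock_glueCols tK12x0c9h2 tK12x20c9h2 rfl rfl) tK12x40c9h2 rfl rfl)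
/-- cell `c9h2`, rows `24…35`, all columns (glued). [folklore] -/
theorem tK24c9h2 : checkCellKBlock (2 ^ 256) C (Xsc9h2.map MC.re) (Xsc9h2.map MC.im) LQf9a tab df9a ec9h2 60 2 (PsdDyadic.unpackSq 64 59 DPc9h2) 24 12 0 59 = true :=
  (checkCellKBlock_glueCols (checkCellKBlock_glueCols tK24x0c9h2 tK24x20c9h2 rfl rfl) tK24x40c9h2 rfl rfl)
/-- cell `c9h2`, rows `36…47`, all columns (glued). [folklore] -/
theorem tK36c9h2 : checkCellKBlock (2 ^ 256) C (Xsc9h2.map MC.re) (Xsc9h2.map MC.im) LQf9a tab df9a ec9h2 60 2 (PsdDyadic.unpackSq 64 59 DPc9h2) 36 12 0 59 = true :=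
  (checkCellKBlock_glueCols (checkCellKBlock_glueCols tK36x0c9h2 tK36x20c9h2 rfl rfl) tK36x40c9h2 rfl rfl)
/-- cell `c9h2`, rows `48…58`, all columns (glued). [folklore] -/
theorem tK48c9h2 : checkCellKBlock (2 ^ 256) C (Xsc9h2.map MC.re) (Xsc9h2.map MC.im) LQf9a tab df9a ec9h2 60 2 (PsdDyadic.unpackSq 64 59 DPc9h2) 48 11 0 59 = true :=
  (checkCellKBlock_glueCols (checkCellKBlock_glueCols tK48x0c9h2 tK48x20c9h2 rfl rfl) tK48x40c9h2 rfl rfl)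
/-- cell `c9h2`: the full `59 × 59` block (checker `K`, glued). [folklore] -/
theorem tRowsc9h2 : checkCellKBlock (2 ^ 256) C (Xsc9h2.map MC.re) (Xsc9h2.map MC.im) LQf9a tab df9a ec9h2 60 2 (PsdDyadic.unpackSq 64 59 DPc9h2) 0 59 0 59 = true :=
  (checkCellKBlock_glueRows (checkCellKBlock_glueRows (checkCellKBlock_glueRows (checkCellKBlock_glueRows tK0c9h2 tK12c9h2 rfl rfl) tK24c9h2 rfl rfl) tK36c9h2 rfl rfl) tK48c9h2 rfl rfl)
/-- `D − δ ≽ 0` with row slack `≥ ρ`. [cite: Higham2002ASNA, Thm. 10.3 / 10.5 (Cholesky backward error; Wilkinson–Demmel)] -/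
theorem tPsdc9h2 : PsdDyadic.checkPsdMid 59 988841445397428 2 (PsdDyadic.unpackSq 64 59 DPc9h2) (PsdDyadic.unpackTri 64 LPc9h2) = true := by
  decide +kernel
/-- cell `c9h2`: the five character values lie in the boxes `Xsc9h2`. [folklore] -/
theorem hXsc9h2 (χ : DirichletCharacter ℂ 9) (hχ : χ (2 : ZMod 9) = Complex.exp (2 * ↑Real.pi * Complex.I / 6) ^ 2) :
    ∀ i < ks.length, MC.mem (2 ^ 256) (χ ((((ks.getD i default).val : ℕ)) : ZMod 9)) (Xsc9h2.getD i default) := by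
  have apply_eq : ∀ k e m : ℕ, ((k : ℕ) : ZMod 9) = (2 : ZMod 9) ^ e → 2 * e = m →
      χ ((k : ℕ) : ZMod 9) = Complex.exp (((2 * π * (m : ℕ) / 6 : ℝ)) * Complex.I) := by
    intro k e m hk hm
    rw [hk, map_pow, hχ, ← pow_mul, hm, ← Complex.exp_nat_mul]
    congr 1
    push_cast
    ring
  intro i hi
  have hi5 : i < 5 := by simpa [ks] using hi
  interval_cases i
  · show MC.mem (2 ^ 256) (χ (((PrimeLen.val ⟨2, 1⟩ : ℕ)) : ZMod 9)) (Xtabf9a.getD 0 default)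
    rw [show (PrimeLen.val ⟨2, 1⟩ : ℕ) = 2 from rfl, apply_eq 2 1 2 (by decide +kernel) rfl]
    exact hXf9a 0 (by norm_num)
  · show MC.mem (2 ^ 256) (χ (((PrimeLen.val ⟨3, 1⟩ : ℕ)) : ZMod 9)) (MC.ofInt (2 ^ 256) 0)
    rw [show (PrimeLen.val ⟨3, 1⟩ : ℕ) = 3 from rfl, MulChar.map_nonunit χ (by rw [ZMod.isUnit_iff_coprime]; decide)]
    exact_mod_cast MC.mem_ofInt (2 ^ 256) 0
  · show MC.mem (2 ^ 256) (χ (((PrimeLen.val ⟨2, 2⟩ : ℕ)) : ZMod 9)) (Xtabf9a.getD 1 default)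
    rw [show (PrimeLen.val ⟨2, 2⟩ : ℕ) = 4 from rfl, apply_eq 4 2 4 (by decide +kernel) rfl]
    exact hXf9a 1 (by norm_num)
  · show MC.mem (2 ^ 256) (χ (((PrimeLen.val ⟨5, 1⟩ : ℕ)) : ZMod 9)) (Xtabf9a.getD 3 default)
    rw [show (PrimeLen.val ⟨5, 1⟩ : ℕ) = 5 from rfl, apply_eq 5 5 10 (by decide +kernel) rfl]
    exact hXf9a 3 (by norm_num)
  · show MC.mem (2 ^ 256) (χ (((PrimeLen.val ⟨7, 1⟩ : ℕ)) : ZMod 9)) (Xtabf9a.getD 2 default)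
    rw [show (PrimeLen.val ⟨7, 1⟩ : ℕ) = 7 from rfl, apply_eq 7 4 8 (by decide +kernel) rfl]
    exact hXf9a 2 (by norm_num)
/-- ★ **Weil positivity on `[−1, 1]` for `L(s, χ)`, `χ` mod 9 with `χ(2) = e(2/6)`** (Conrey `9.4`, order 3; door C at `a = 1`,
shape `30`/`150`, kernel margin `λ = 0.0017`). -/
theorem weilPositivityOnChar_mod9_chi4_one (χ : DirichletCharacter ℂ 9) (hχ : χ (2 : ZMod 9) = Complex.exp (2 * ↑Real.pi * Complex.I / 6) ^ 2) :
    WeilPositivityOnChar χ 1 := by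
  have hXs := hXsc9h2 χ hχ
  have hx : ∀ i < ks.length, MI.mem (2 ^ 256) (χ ((((ks.getD i default).val : ℕ)) : ZMod 9)).re ((Xsc9h2.map MC.re).getD i default) := fun i hi ↦ by
    show MI.mem _ _ ((Xsc9h2.map MC.re).getD i (MC.re default)); rw [List.getD_map]; exact (hXs i hi).1
  have hy : ∀ i < ks.length, MI.mem (2 ^ 256) (χ ((((ks.getD i default).val : ℕ)) : ZMod 9)).im ((Xsc9h2.map MC.im).getD i default) := fun i hi ↦ by
    show MI.mem _ _ ((Xsc9h2.map MC.im).getD i (MC.im default)); rw [List.getD_map]; exact (hXs i hi).2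
  have hT : TabValid (2 ^ 256) a ks 161 tab :=
    (((((((((tabv26).extend fun n hn hnk ↦ FastLight.idxValid_of_checkTableFast (by norm_num) a_pos consts_valid tTF26 hn hnk).extend fun n hn hnk ↦ FastLight.idxValid_of_checkTableFast (by norm_num) a_pos consts_valid tTF41 hn hnk).extend fun n hn hnk ↦ FastLight.idxValid_of_checkTableFast (by norm_num) a_pos consts_valid tTF56 hn hnk).extend fun n hn hnk ↦ FastLight.idxValid_of_checkTableFast (by norm_num) a_pos consts_valid tTF71 hn hnk).extend fun n hn hnk ↦ FastLight.idxValid_of_checkTableFast (by norm_num) a_pos consts_valid tTF86 hn hnk).extend fun n hn hnk ↦ FastLight.idxValid_of_checkTableFast (by norm_num) a_pos consts_valid tTF101 hn hnk).extend fun n hn hnk ↦ FastLight.idxValid_of_checkTableFast (by norm_num) a_pos consts_valid tTF116 hn hnk).extend fun n hn hnk ↦ FastLight.idxValid_of_checkTableFast (by norm_num) a_pos consts_valid tTF131 hn hnk).extend fun n hn hnk ↦ FastLight.idxValid_of_checkTableFast (by norm_num) a_pos consts_valid tTF146 hn hnk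
  have h := weilPositivityOnChar_of_checkCellK (q := 9) (by norm_num) (by positivity) a_pos (Karc := 128) primeData consts_valid χ hx hy
    hLQf9a hT (d := df9a) (e := ec9h2) (by decide) hCCf9a hAOPf9a tSCf9a tHDc9h2 tRowsc9h2 tPsdc9h2
  convert h using 2
  norm_num [a]
/-- ★ the CONJUGATE class `χ(2) = e(4/6)` (Conrey `9.7`): `weilPositivityOnChar_mod9_chi4_one` for `χ⁻¹`, transferred by
`WeilPositivityOnChar χ⁻¹ a ↔ WeilPositivityOnChar χ a`. -/
theorem weilPositivityOnChar_mod9_chi4_one_conj (χ : DirichletCharacter ℂ 9) (hχ : χ (2 : ZMod 9) = Complex.exp (2 * ↑Real.pi * Complex.I / 6) ^ 4) :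
    WeilPositivityOnChar χ 1 := by
  have hinv : χ⁻¹ (2 : ZMod 9) = Complex.exp (2 * ↑Real.pi * Complex.I / 6) ^ 2 := by
    rw [MulChar.inv_apply_eq_inv', hχ]
    exact inv_eq_of_mul_eq_one_right (by rw [← pow_add]; exact_mod_cast (Complex.isPrimitiveRoot_exp 6 (by norm_num)).pow_eq_one)
  exact (weilPositivityOnChar_inv_iff χ 1).mp (weilPositivityOnChar_mod9_chi4_one χ⁻¹ hinv)

end Summit.Ventures.WeilGRH.KCellsMod9OneA

end
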